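import Mathlib

/-!
# Tier7/Line3/DoubleCosetCover — a compact set meets finitely many double cosets of an open subgroup, and the
per-place constant of the split places as a theorem of `(K, U, c)`
(seat t7-L1-p2, gen 7; plan-3's assignment STATUS l. 16065 (h⁵⁗′); TARGET l. 16067)

LINE 3 (t7-plan-3), version (ii). SplitFactorConstants p711068 (L1-p3) displays, at a split place `w` of the finite set
`S`, the per-place constant `Cw w = Σ_j (1 + |m_j − n_j|)²` with `1 ≤ Cw w`, presupposing that the compact open support
`U_w ⊂ GL₂(F_w)` meets only FINITELY MANY double cosets `K g K` of `K = GL₂(O_w)` — the one clause of that row still in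
words that is a theorem of the MODEL and not of the dictionary. This module makes it one, Mathlib only:
* (a) `isOpen_doubleCoset`: for an OPEN subgroup `K` of a topological group `G`, every double coset `K a K` (Mathlib's
  `DoubleCoset.doubleCoset a K K = K * {a} * K`) is open (`IsOpen.mul_right` twice);
* (b) `exists_finset_doubleCoset_cover`: a COMPACT `U ⊆ G` is covered by the double cosets of finitely many of its own
  points (`IsCompact.elim_finite_subcover_image` on `u ↦ K u K`, `u ∈ K u K` since `1 ∈ K`);
* (c) `finite_image_mk`: the image of `U` in `K \ G / K` (`DoubleCoset.mk K K`) is FINITE (every `u ∈ U` lies in `K t K`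
  for one of the finitely many `t`, hence `mk u = mk t`);
* (d) THE CONSTANT: for a displayed cost `c : K \ G / K → ℝ` with `1 ≤ c` (the Cartan cost `(1 + |m_q − n_q|)²` of a
  coset — the Cartan parametrisation `K \ GL₂(F_w) / K ≅ {(m, n) | m ≥ n}` stays in words), `coverSum` = the sum of `c`
  over the finitely many cosets met by `U` satisfies `c (mk u) ≤ coverSum` for every `u ∈ U` (`le_coverSum`) and
  `1 ≤ coverSum` when `U ≠ ∅` (`one_le_coverSum`); the unconditional constant `coverConst = max 1 coverSum` has both
  properties with no hypothesis on `U` (`one_le_coverConst`, `le_coverConst`) — exactly the displayed shape `hCw1` of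
  SplitFactorConstants, now a theorem of `(K, U, c)`; OFF `S` (plan-3 l. 16073 (1), crit-2's (iii)): a non-empty
  `U ⊆ K` meets only the trivial coset, so `coverSum = c (mk 1)` and, with the trivial coset of cost `1`,
  `coverConst = 1` (`coverSum_eq_of_subset`, `coverConst_eq_one_of_subset`) — `Cw w = 1` off `S` as a theorem. WHAT THE
  PAIR DISCHARGES (crit-1 (vii), l. 16082): of SplitFactorConstants' displayed `hCw1 : ∀ w, 1 ≤ Cw w` the value at ONE
  place is `one_le_coverConst` (`Cw w := coverConst (K_w, U_w, c_w)`), and of its «`Cw w = 1` off `S`» the value at one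
  place off `S` is `coverConst_eq_one_of_subset` under `U_w ⊆ K_w`; what stays in words ([W], (a′)): that the real
  `supp f_w` IS `K_w` off `S`, and the finiteness of `S` behind the finite `mulSupport` of `Cw` — a sentence of the
  dictionary, not a binder here;
* (e) THE MODEL `K = GL₂(O)`: for a subring `O` of a topological ring `F`, `integralSubgroup O` = the units of `M₂(F)`
  whose matrix and inverse matrix have all entries in `O` is a SUBGROUP of `GL (Fin 2) F` (entries of a product are
  sums of products in `O`; inversion swaps the two clauses), and it is OPEN when `O` is open in `F`
  (`isOpen_integralSubgroup`: the carrier is the preimage, under Mathlib's inducing map `Units.embedProduct`, of the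
  open set of pairs `(m, op m′)` with all entries of `m` and `m′` in `O`). The hypothesis `IsOpen (O : Set F)` is
  DISPLAYED — for the model `O = O_w`, the valuation ring of `F_w`, open as the closed unit ball of an ultrametric
  field; which subring it is: the dictionary, in words.
WHAT STAYS IN WORDS (the dictionary, (a′)): `U = supp f_w` compact open, `K = GL₂(O_w)`, the Cartan parametrisation
behind `c`, and the identification of the place datum with the real one. `[M]`-level; NOT distance to (P); residual
(a′)/(b′) unchanged in kind; LEMMAS CLOSING THE STEP 0. Nothing here is about (N), (P), the real `X`, or HC_CM;
§8(d): NO. Blind lane: Mathlib + the HodgeRepro2 prefix; no sorry; axioms ⊆ {propext, Classical.choice, Quot.sound}.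
-/

namespace Summit.Ventures.HodgeRepro2.Tier7.Line3.DoubleCosetCover

open DoubleCoset Set
open scoped Pointwise

section Cover

variable {G : Type*} [Group G] [TopologicalSpace G] [IsTopologicalGroup G]

/-- **(a)** the double cosets `K a K` of an open subgroup are open. -/
theorem isOpen_doubleCoset (K : Subgroup G) (hK : IsOpen (K : Set G)) (a : G) :
    IsOpen (doubleCoset a (K : Set G) K) :=
  hK.mul_right.mul_right

/-- **(b)** a compact set is covered by the double cosets of finitely many of its own points. -/
theorem exists_finset_doubleCoset_cover (K : Subgroup G) (hK : IsOpen (K : Set G)) {U : Set G}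
    (hU : IsCompact U) :
    ∃ T : Finset G, (T : Set G) ⊆ U ∧ U ⊆ ⋃ t ∈ T, doubleCoset t (K : Set G) K := by
  obtain ⟨b', hb'U, hfin, hcov⟩ := hU.elim_finite_subcover_image (b := U)
    (c := fun u => doubleCoset u (K : Set G) K) (fun u _ => isOpen_doubleCoset K hK u)
    (fun u hu => mem_iUnion₂.2 ⟨u, hu, mem_doubleCoset_self K K u⟩)
  refine ⟨hfin.toFinset, by simpa using hb'U, fun u hu => ?_⟩
  obtain ⟨t, ht, hut⟩ := mem_iUnion₂.1 (hcov hu)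
  exact mem_iUnion₂.2 ⟨t, hfin.mem_toFinset.2 ht, hut⟩

/-- **(c)** a compact set meets only finitely many double cosets of an open subgroup: its image in `K \ G / K` is
finite. -/
theorem finite_image_mk (K : Subgroup G) (hK : IsOpen (K : Set G)) {U : Set G} (hU : IsCompact U) :
    (mk K K '' U).Finite := by
  obtain ⟨T, -, hcov⟩ := exists_finset_doubleCoset_cover K hK hU
  refine (T.finite_toSet.image (mk K K)).subset ?_
  rintro _ ⟨u, hu, rfl⟩
  obtain ⟨t, ht, hut⟩ := mem_iUnion₂.1 (hcov hu)
  exact ⟨t, ht, (mk_eq_of_doubleCoset_eq (doubleCoset_eq_of_mem hut)).symm⟩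

/-! ## (d) The per-place constant as a theorem of `(K, U, c)` -/

variable (K : Subgroup G) (hK : IsOpen (K : Set G)) {U : Set G} (hU : IsCompact U)
  (c : DoubleCoset.Quotient (K : Set G) K → ℝ)

/-- the sum of the cost `c` over the finitely many double cosets met by `U`. -/
noncomputable def coverSum : ℝ := ∑ q ∈ (finite_image_mk K hK hU).toFinset, c q

/-- every coset met by `U` costs at most the sum (`c ≥ 1`). -/
theorem le_coverSum (hc : ∀ q, 1 ≤ c q) {u : G} (hu : u ∈ U) : c (mk K K u) ≤ coverSum K hK hU c :=
  Finset.single_le_sum (fun q _ => zero_le_one.trans (hc q))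
    ((finite_image_mk K hK hU).mem_toFinset.2 ⟨u, hu, rfl⟩)

/-- the sum is at least `1` when `U` is non-empty. -/
theorem one_le_coverSum (hc : ∀ q, 1 ≤ c q) (hne : U.Nonempty) : 1 ≤ coverSum K hK hU c :=
  let ⟨_, hu⟩ := hne
  (hc _).trans (le_coverSum K hK hU c hc hu)

/-- **the per-place constant** `Cw = max 1 (coverSum)`: at least `1`, and at least the cost of every coset met by `U`
— the displayed shape `hCw1` of SplitFactorConstants as a theorem of `(K, U, c)`. -/
noncomputable def coverConst : ℝ := max 1 (coverSum K hK hU c)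

/-- `1 ≤ Cw`. -/
theorem one_le_coverConst : 1 ≤ coverConst K hK hU c := le_max_left _ _

/-- every coset met by `U` costs at most `Cw`. -/
theorem le_coverConst (hc : ∀ q, 1 ≤ c q) {u : G} (hu : u ∈ U) : c (mk K K u) ≤ coverConst K hK hU c :=
  (le_coverSum K hK hU c hc hu).trans (le_max_right _ _)

/-- the two properties together, as SplitFactorConstants displays them. -/
theorem coverConst_spec (hc : ∀ q, 1 ≤ c q) :
    1 ≤ coverConst K hK hU c ∧ ∀ u ∈ U, c (mk K K u) ≤ coverConst K hK hU c :=
  ⟨one_le_coverConst K hK hU c, fun _ hu => le_coverConst K hK hU c hc hu⟩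

/-! ## The value off `S`: `U ⊆ K` meets one coset, the trivial one -/

omit [TopologicalSpace G] [IsTopologicalGroup G] in
/-- an element of `K` lies in the trivial double coset: `mk K K u = mk K K 1`. -/
theorem mk_eq_mk_one_of_mem {u : G} (hu : u ∈ K) : mk K K u = mk K K 1 :=
  ((eq K K 1 u).2 ⟨u, hu, 1, K.one_mem, by rw [mul_one, mul_one]⟩).symm

/-- when `U ⊆ K` is non-empty, `U` meets exactly the trivial coset. -/
theorem toFinset_eq_singleton_of_subset (hUK : U ⊆ K) (hne : U.Nonempty) :
    (finite_image_mk K hK hU).toFinset = {mk K K 1} := by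
  obtain ⟨u₀, hu₀⟩ := hne
  ext q
  rw [Set.Finite.mem_toFinset, Finset.mem_singleton]
  constructor
  · rintro ⟨u, hu, rfl⟩
    exact mk_eq_mk_one_of_mem K (hUK hu)
  · rintro rfl
    exact ⟨u₀, hu₀, mk_eq_mk_one_of_mem K (hUK hu₀)⟩

/-- **the value off `S`**: for non-empty `U ⊆ K` the sum is the cost of the trivial coset. -/
theorem coverSum_eq_of_subset (hUK : U ⊆ K) (hne : U.Nonempty) : coverSum K hK hU c = c (mk K K 1) := by
  unfold coverSum
  rw [toFinset_eq_singleton_of_subset K hK hU hUK hne, Finset.sum_singleton]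

/-- with the trivial coset of cost `1` (`hc1`, the Cartan cost `(1 + |0 − 0|)²`), the constant off `S` is `1` —
SplitFactorConstants' `Cw w = 1` off `S` as a theorem of `U_w ⊆ K_w`. -/
theorem coverConst_eq_one_of_subset (hc1 : c (mk K K 1) = 1) (hUK : U ⊆ K) (hne : U.Nonempty) :
    coverConst K hK hU c = 1 := by
  unfold coverConst
  rw [coverSum_eq_of_subset K hK hU c hUK hne, hc1, max_self]

end Cover

/-! ## (e) The model `K = GL₂(O)`: an open subgroup of `GL (Fin 2) F` for an open subring `O` -/

section Integral

open Matrix MulOpposite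

variable {F : Type*} [CommRing F] (O : Subring F)

/-- the entries of a product of two matrices with entries in `O` lie in `O`. -/
theorem mul_entry_mem {m n : Matrix (Fin 2) (Fin 2) F} (hm : ∀ i j, m i j ∈ O) (hn : ∀ i j, n i j ∈ O)
    (i j : Fin 2) : (m * n) i j ∈ O := by
  rw [Matrix.mul_apply]
  exact O.sum_mem fun k _ => O.mul_mem (hm i k) (hn k j)

/-- **the integral units** `GL₂(O)` = the units of `M₂(F)` whose matrix and inverse matrix have entries in `O`. -/
def integralSubgroup : Subgroup (GL (Fin 2) F) where
  carrier := {g | (∀ i j, (g : Matrix (Fin 2) (Fin 2) F) i j ∈ O) ∧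
    ∀ i j, ((g⁻¹ : GL (Fin 2) F) : Matrix (Fin 2) (Fin 2) F) i j ∈ O}
  one_mem' := by
    refine ⟨fun i j => ?_, fun i j => ?_⟩
    · rw [Units.val_one, Matrix.one_apply]
      split_ifs <;> simp
    · rw [inv_one, Units.val_one, Matrix.one_apply]
      split_ifs <;> simp
  mul_mem' := by
    rintro g h ⟨hg, hg'⟩ ⟨hh, hh'⟩
    refine ⟨fun i j => ?_, fun i j => ?_⟩
    · rw [Units.val_mul]
      exact mul_entry_mem O hg hh i j
    · rw [_root_.mul_inv_rev, Units.val_mul]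
      exact mul_entry_mem O hh' hg' i j
  inv_mem' := by
    rintro g ⟨hg, hg'⟩
    refine ⟨hg', fun i j => ?_⟩
    rw [inv_inv]
    exact hg i j

/-- membership in `GL₂(O)`, by definition. -/
theorem mem_integralSubgroup (g : GL (Fin 2) F) :
    g ∈ integralSubgroup O ↔ (∀ i j, (g : Matrix (Fin 2) (Fin 2) F) i j ∈ O) ∧
      ∀ i j, ((g⁻¹ : GL (Fin 2) F) : Matrix (Fin 2) (Fin 2) F) i j ∈ O :=
  Iff.rfl

variable [TopologicalSpace F]

omit [CommRing F] in
/-- the entry maps of `M₂(F)` are continuous. -/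
theorem continuous_entry (i j : Fin 2) : Continuous fun m : Matrix (Fin 2) (Fin 2) F => m i j :=
  (continuous_apply j).comp (continuous_apply i)

/-- the set of pairs `(m, op m′)` with all entries of `m` and `m′` in an open `O` is open in `M₂(F) × M₂(F)ᵐᵒᵖ`. -/
theorem isOpen_pairs (hO : IsOpen (O : Set F)) :
    IsOpen {p : Matrix (Fin 2) (Fin 2) F × (Matrix (Fin 2) (Fin 2) F)ᵐᵒᵖ |
      (∀ i j, p.1 i j ∈ O) ∧ ∀ i j, (unop p.2) i j ∈ O} := by
  have h1 : IsOpen {p : Matrix (Fin 2) (Fin 2) F × (Matrix (Fin 2) (Fin 2) F)ᵐᵒᵖ | ∀ i j, p.1 i j ∈ O} := by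
    simp only [setOf_forall]
    exact isOpen_iInter_of_finite fun i => isOpen_iInter_of_finite fun j =>
      hO.preimage ((continuous_entry i j).comp continuous_fst)
  have h2 : IsOpen {p : Matrix (Fin 2) (Fin 2) F × (Matrix (Fin 2) (Fin 2) F)ᵐᵒᵖ | ∀ i j, (unop p.2) i j ∈ O} := by
    simp only [setOf_forall]
    exact isOpen_iInter_of_finite fun i => isOpen_iInter_of_finite fun j =>
      hO.preimage ((continuous_entry i j).comp (continuous_unop.comp continuous_snd))
  exact h1.inter h2

/-- **`GL₂(O)` is an open subgroup** of `GL (Fin 2) F` when `O` is open in `F` (the carrier is the preimage of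
`isOpen_pairs` under the inducing map `Units.embedProduct`). -/
theorem isOpen_integralSubgroup (hO : IsOpen (O : Set F)) :
    IsOpen ((integralSubgroup O : Subgroup (GL (Fin 2) F)) : Set (GL (Fin 2) F)) := by
  rw [Units.isInducing_embedProduct.isOpen_iff]
  refine ⟨_, isOpen_pairs O hO, ?_⟩
  ext g
  simp only [Set.mem_preimage, Units.embedProduct_apply, Set.mem_setOf_eq, MulOpposite.unop_op,
    SetLike.mem_coe, mem_integralSubgroup]

end Integral

end Summit.Ventures.HodgeRepro2.Tier7.Line3.DoubleCosetCover
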